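import Literature.Analysis.FluidPDE.NSForcedH1ContinuationOfLocalExistence
import Literature.Analysis.FluidPDE.TaoH1LocalExistenceForcedHolds
import HarnessLib

/-!
# Discharge of `lemarieRieusset2016_H1_continuation_forced` (Lemarié-Rieusset 2016, Thm. 7.2: the
# `H¹` blow-up alternative WITH a force): the «hC» leaf of the cell `ns-blowup`'s E–C lane is a THEOREM

Analysis/FluidPDE proof file (no definitions, no named facts; net debt −1). The named fact
`Literature.Analysis.FluidPDE.lemarieRieusset2016_H1_continuation_forced` (`NSForcedH1Continuation.lean`:
a classical solution of the forced system on `[0, T)` in Tao's class on closed sub-slabs, with finite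
energy, Schwartz datum, Clay-class force and ENSTROPHY BOUNDED up to `T`, extends classically past `T`)
was REDUCED by `lemarieRieusset2016_H1_continuation_forced_of_smooth_local_existence`
(`NSForcedH1ContinuationOfLocalExistence.lean`, seat `ns-blowup-lit` g10) to the forced local existence
fact `tao2011_smooth_local_existence_forced` (Tao 2013, Thm. 5.4 (ii)+(iv) with forcing), which is
now DISCHARGED (`tao2011_smooth_local_existence_forced_holds`, `TaoH1LocalExistenceForcedHolds.lean`).
This file composes the two (turnkey of `ns-blowup-lit` g10, filed by `ns-blowup-ecbridge-7` g3).
Consumers (cell `ns-blowup`): `Summits/NavierStokesRegularity/FluidComputer/DesignedBlowupSerrinDivergence`,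
`…/PalasekTowerSerrinDivergence`, `…/SerrinDivergenceMaximalForced`,
`Literature/Analysis/FluidPDE/NSForcedH1ContinuationOfLerayRate`.

## References

* P. G. Lemarié-Rieusset, *The Navier–Stokes Problem in the 21st Century*, CRC Press (2016),
  Thm. 7.2 (p. 125) with Thm. 7.3 and (11.10). [LemarieRieusset2016]
* T. Tao, Anal. PDE 6 (2013) = arXiv:1108.1165, Thm. 5.4 (ii)–(iv). [Tao2011]
-/

noncomputable section

namespace Literature.Analysis.FluidPDE

/-- **Lemarié-Rieusset 2016, Thm. 7.2 WITH a force — DISCHARGED**: a classical solution of the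
forced Navier–Stokes system on `ℝ³ × [0, T)` (`ν > 0`), in Tao's class on every closed sub-slab, with
finite energy, Schwartz datum, a Clay-class force and enstrophy bounded up to `T`, extends past `T` as a
classical solution with the same force (the content of `lemarieRieusset2016_H1_continuation_forced`).
[cite: LemarieRieusset2016, Thm. 7.2 (p. 125) with Thm. 7.3 and (11.10)] -/
theorem lemarieRieusset2016_H1_continuation_forced_holds : lemarieRieusset2016_H1_continuation_forced :=
  lemarieRieusset2016_H1_continuation_forced_of_smooth_local_existence
    tao2011_smooth_local_existence_forced_holds

end Literature.Analysis.FluidPDE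

end
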